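import Summits.HodgeConjecture.HodgeConjecture.Cruxes.BlochSeedDiscOne.SlotLatticeLaw
import Summits.HodgeConjecture.HodgeConjecture.Cruxes.BlochSeedDiscOne.HeightTower

/-!
# LineChargeLaw — the TRUE-LINE charge tower, the parity ∕ factor calculus, and the LINE and ONE-SLOT μ-laws modulo the μ-coupling
# (plan-lens-HodgeAV-strengthen g14, MEMO-21; companion file `LineChargeMuLaw.lean` discharges the coupling from `ChargeLatticeLaw`)

line stmt-HodgeConjecture-18881 Cruxes/BlochSeedDiscOne/Lines/birth.lean 814a6a70c14e831a stub_rung_pad4_seedAt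

STATUS WORD.  KERNEL facts about the integer LETTER ∕ DESIGN model of `DepthBoundA4` (letters ≠ sheaves ≠ a SEED).  Evidence-grade,
census-neutral: nothing here is proved toward HC ∕ HC_CM ∕ HC_AV ∕ №4 ∕ 26512 ∕ 18881 ∕ H2, nor toward `Nonex 14 199 8`,
`FloorFree 6 199 8` or `stub_rung_pad4_seedAt`.  Officer g19 TABLE #3 §1.5 (idea-crit-6) parked this lens «unless MINMU (μ = ±16 ± 16i under
(A4)?) or per-region sub-alphabet lattices are wanted»; this file and its companion are the sub-alphabet half in the kernel, MEMO-21 §4 the MINMU-(A4) half.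

TWO FILES.  Everything that needs only the slot lattice (`SlotLatticeLaw`) and the shift ∕ cell-map calculus (`HeightTower`) is HERE and
unconditional; the two inputs that need the charge-lattice functionals of `ChargeLatticeLaw` (g13, MEMO-20) are isolated as hypotheses —
`MuCoupling h` (= `ChargeLatticeLaw.mu_law`: `Re μ ≡ Im μ ≡ 2q₄ (mod 32)`) and `Slot2Q4Law h` (`16 ∣ q₄` when factor 2 is odd-odd-free, from
`ChargeLatticeLaw.Φ2_po`) — and discharged in `LineChargeMuLaw.lean`, which turns every `_of` theorem below into an unconditional one.

A LINE design is an integer design (`DepthBoundA4.Design`: cells with ℕ-multiplicities, virtual `T = Σ_N − Σ_P`) all of whose support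
letters are AXIS letters `x·y = 0` (`Letter.isAxis`); the height-`h` LINE alphabet has `4h+1` letters.  Results:

* (LINE IDENTITY, §2) on an axis letter of height `h`, `n = a² − |β|² = 2ha − h²` (`selfInt_axis`): the moment vector `(1,a,n,x,y)` of the LINE
  alphabet spans a rank-4 lattice (rank 5 on the full alphabet) — the isotropic ray `(L − hH)² = 0`.
* (LINE RECURSION, §3, any `h`, no (A1)) `T(p·w) = 2h·T(h·w) − h²·T(1·w)` for every tail `w` (`line_rec`).
* (TRUE-LINE TOWER, §4, any `h`, (A1)) `q_d = h^{d−1}·(d·q₁ − (d−1)·h·rank)`, `d = 2 … 8` (`line_tower`); with `SlotLatticeLaw.two_dvd_q1`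
  (`q₁ ∈ 2ℤ` at even `h`) `q₄ ∈ 16ℤ` on a LINE (`line_q4_sixteen`; the full alphabet only has `8 ∣ q₄`).
* (LINE μ-LAW modulo the coupling, §5) `MuCoupling` at even heights ⇒ `μ ∈ 32ℤ[i]` on every LINE_h, EVERY `h` (odd `h` by the shift
  `HeightTower.shiftD 1`: (A1), μ and the axis property are shift-invariant) — `line_mu_law_of`, `lineChargeLaw_of`; hence `μ ≠ 0 ⇒ |μ|² ≥ 1024`
  and `|μ|² ≠ 512` (`normSq_ge_of_thirtytwo_dvd`, `normSq_ne_512_of_thirtytwo_dvd`).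
* (PARITY CALCULUS, §7) ODD-ODD letters `x ≡ y ≡ 1 (2)`: `4 ∣ n` off that class, `n ≡ 2 (4)` on it (`four_dvd_selfInt`, `selfInt_oddOdd`);
  FACTOR PERMUTATIONS `permD σ` preserve `T` up to relabelling, μ, (A1), the alphabet (`T_permD`, `mu_permD`, `a1_permD`, `onAlphabet_permD`).
* (ONE-SLOT LAW modulo the two inputs, §7.3) `Slot2Q4Law` ∧ `MuCoupling` at even heights ⇒ for EVERY `h`: one odd-odd-free factor ⇒ `μ ∈ 32ℤ[i]`
  (`slot_mu_law_of`, `oneSlotLaw_of`), and the FOUR-FACTOR THEOREM `0 < |μ|² < 1024 ⇒` an odd-odd letter in EACH factor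
  (`oddOdd_every_factor_of_small_mu_of`).

EXACT COMPANION (stdlib engine `memo-21/eng/`): LINE_h charge lattice = rank 4, index exactly `2¹¹`, μ-projection `32ℤ ⊕ 32ℤi` for `h = 2 … 32`;
per-factor alphabets: one odd-odd-free factor ⇒ `q₄ ∈ 16ℤ`, `μ ∈ 32ℤ[i]` (index `2⁴⁰`), none ⇒ `μ = 16+16i` occurs; parity-class table in MEMO-21 §3;
MINMU-(A4): explicit integer (A1) ∧ (A4) rank-8 designs with `μ = 16+16i` at `h = 14, 16` (certificates `memo-21/minmu/`, MEMO-21 §4).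

No `sorry`, no new axioms, no `instance`, no `notation`, no `native_decide`, no unsafe reducibility.
-/

set_option linter.dupNamespace false
set_option autoImplicit false

namespace Summit.HodgeConjecture.HodgeConjecture.Cruxes.BlochSeedDiscOne.LineChargeLaw

open Summit.HodgeConjecture.HodgeConjecture.Cruxes.BlochSeedDiscOne.DepthBoundA4
open Summit.HodgeConjecture.HodgeConjecture.Cruxes.BlochSeedDiscOne.SlotLatticeLaw
open Summit.HodgeConjecture.HodgeConjecture.Cruxes.BlochSeedDiscOne.HeightTower
  (shiftL shiftCell shiftD a1_shiftD mu_shiftD onAlphabet_shift_up suppN_shift suppP_shift rank_shift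
   mapD suppN_mapD suppP_mapD T_mapD T_eq_Tf Tf_congr)

/-! ## §1 LINE designs (axis-supported) -/

/-- `D` lives on the LINE sub-alphabet: every letter of every support cell is an axis letter (`x·y = 0`). -/
def OnLine (D : Design) : Prop := ∀ c ∈ D.suppN ++ D.suppP, ∀ f : Fin 4, (c f).isAxis

theorem onLine_N' (D : Design) (hL : OnLine D) : ∀ cm ∈ D.N, 0 < cm.2 → ∀ f : Fin 4, (cm.1 f).isAxis := by
  intro cm hcm hpos f
  have hc : cm.1 ∈ D.suppN := (mem_suppN_iff D cm.1).mpr ⟨cm.2, hcm, hpos⟩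
  exact hL cm.1 (List.mem_append.mpr (Or.inl hc)) f

theorem onLine_P' (D : Design) (hL : OnLine D) : ∀ cm ∈ D.P, 0 < cm.2 → ∀ f : Fin 4, (cm.1 f).isAxis := by
  intro cm hcm hpos f
  have hc : cm.1 ∈ D.suppP := (mem_suppP_iff D cm.1).mpr ⟨cm.2, hcm, hpos⟩
  exact hL cm.1 (List.mem_append.mpr (Or.inr hc)) f

/-- Divisibility of an integer cell sum from cell-wise divisibility on LINE alphabet cells. -/
theorem dvd_Lz_line (h : ℤ) (D : Design) (hA : D.OnAlphabet h) (hL : OnLine D) (φ : Cell → ℤ) (d : ℤ)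
    (hφ : ∀ c : Cell, (∀ f : Fin 4, (c f).OnAlphabet h) → (∀ f : Fin 4, (c f).isAxis) → d ∣ φ c) : d ∣ Lz D φ := by
  unfold Lz
  exact dvd_sub
    (dvd_linZ _ _ _ fun cm hcm hpos => hφ _ (onAlpha_N' h D hA cm hcm hpos) (onLine_N' D hL cm hcm hpos))
    (dvd_linZ _ _ _ fun cm hcm hpos => hφ _ (onAlpha_P' h D hA cm hcm hpos) (onLine_P' D hL cm hcm hpos))

/-- A cell function vanishing on LINE alphabet cells has vanishing design sum. -/
theorem Lz_eq_zero_line (h : ℤ) (D : Design) (hA : D.OnAlphabet h) (hL : OnLine D) (φ : Cell → ℤ)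
    (hφ : ∀ c : Cell, (∀ f : Fin 4, (c f).OnAlphabet h) → (∀ f : Fin 4, (c f).isAxis) → φ c = 0) : Lz D φ = 0 :=
  zero_dvd_iff.mp (dvd_Lz_line h D hA hL φ 0 fun c hc hx => by rw [hφ c hc hx])

/-- The axis property is invariant under the height shift `a ↦ a + t`. -/
theorem onLine_shiftD (t : ℤ) (D : Design) (hL : OnLine D) : OnLine (shiftD t D) := by
  intro c hc f
  have hc' : c ∈ (D.suppN ++ D.suppP).map (shiftCell t) := by
    rw [List.map_append, ← suppN_shift, ← suppP_shift]; exact hc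
  obtain ⟨c₀, hc₀, rfl⟩ := List.mem_map.mp hc'
  have h0 := hL c₀ hc₀ f
  unfold Letter.isAxis at h0 ⊢
  simpa [shiftCell, shiftL] using h0

/-! ## §2 The LINE letter identity `n = 2ha − h²` -/

/-- On an axis letter of the height-`h` alphabet `|β| = h − a`, so `n = a² − |β|² = 2ha − h²` (`(L − hH)² = 0`). -/
theorem selfInt_axis (h : ℤ) (ℓ : Letter) (hℓ : ℓ.OnAlphabet h) (hx : ℓ.isAxis) : ℓ.selfInt = 2 * h * ℓ.a - h ^ 2 := by
  obtain ⟨hh, _⟩ := hℓ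
  unfold Letter.height at hh
  unfold Letter.isAxis at hx
  unfold Letter.selfInt Letter.bnorm
  rcases mul_eq_zero.mp hx with h0 | h0
  · rw [h0] at hh ⊢
    simp only [abs_zero, add_zero] at hh
    have hy : |ℓ.y| = h - ℓ.a := by linarith
    have e : ℓ.y ^ 2 = (h - ℓ.a) ^ 2 := by rw [← sq_abs, hy]
    rw [e]; ring
  · rw [h0] at hh ⊢
    simp only [abs_zero, add_zero] at hh
    have hy : |ℓ.x| = h - ℓ.a := by linarith
    have e : ℓ.x ^ 2 = (h - ℓ.a) ^ 2 := by rw [← sq_abs, hy]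
    rw [e]; ring

/-! ## §3 The LINE recursion in slot 0: `T(p·w) = 2h·T(h·w) − h²·T(1·w)` -/

/-- the word `s₀ s₁ s₂ s₃` (definitionally `ChargeLatticeLaw.W`; restated to keep this file independent of that import). -/
def W4 (s0 s1 s2 s3 : Sym) : Word := ![s0, s1, s2, s3]

theorem icellCoef_W4 (c : Cell) (s0 s1 s2 s3 : Sym) :
    icellCoef c (W4 s0 s1 s2 s3) = s0.icoef (c 0) * s1.icoef (c 1) * s2.icoef (c 2) * s3.icoef (c 3) := by
  unfold icellCoef W4; simp [Fin.prod_univ_four]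

/-- The slot-0 LINE defect `p − 2h·h + h²·1` of a cell, tail `s₁ s₂ s₃`. -/
def lineDefect (h : ℤ) (s1 s2 s3 : Sym) (c : Cell) : ℤ :=
  icellCoef c (W4 .pt s1 s2 s3) - 2 * h * icellCoef c (W4 .h s1 s2 s3) + h ^ 2 * icellCoef c (W4 .one s1 s2 s3)

theorem lineDefect_eq_zero (h : ℤ) (s1 s2 s3 : Sym) (c : Cell) (hc : ∀ f : Fin 4, (c f).OnAlphabet h)
    (hx : ∀ f : Fin 4, (c f).isAxis) : lineDefect h s1 s2 s3 c = 0 := by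
  unfold lineDefect
  rw [icellCoef_W4, icellCoef_W4, icellCoef_W4]
  simp only [Sym.icoef]
  rw [selfInt_axis h (c 0) (hc 0) (hx 0)]
  ring

/-- LINE RECURSION (any `h`, any tail, no (A1) needed). -/
theorem line_rec (h : ℤ) (D : Design) (hA : D.OnAlphabet h) (hL : OnLine D) (s1 s2 s3 : Sym) :
    D.Tz (W4 .pt s1 s2 s3) = 2 * h * D.Tz (W4 .h s1 s2 s3) - h ^ 2 * D.Tz (W4 .one s1 s2 s3) := by
  have h0 : Lz D (lineDefect h s1 s2 s3) = 0 :=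
    Lz_eq_zero_line h D hA hL _ fun c hc hx => lineDefect_eq_zero h s1 s2 s3 c hc hx
  have e : lineDefect h s1 s2 s3 = fun c =>
      (icellCoef c (W4 .pt s1 s2 s3) - 2 * h * icellCoef c (W4 .h s1 s2 s3)) + h ^ 2 * icellCoef c (W4 .one s1 s2 s3) := by
    funext c; rfl
  rw [e, Lz_add, Lz_sub, Lz_mul, Lz_mul] at h0
  rw [Tz_eq_Lz, Tz_eq_Lz, Tz_eq_Lz]
  linarith

/-! ## §4 The TRUE-LINE tower: all real charges from `(rank, q₁)` -/

/-- `T(1111) = rank`. -/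
theorem Tz_oooo (D : Design) : D.Tz (W4 .one .one .one .one) = D.rank := by
  have er : D.rank = Lz D pre0 := by
    unfold Design.rank Lz linZ pre0; simp [Function.comp_def]
  have e : (fun c : Cell => icellCoef c (W4 .one .one .one .one)) = pre0 := by
    funext c; simp [icellCoef_W4, Sym.icoef, pre0]
  rw [er, Tz_eq_Lz, e]

theorem W4_efree {s0 s1 s2 s3 : Sym} (h0 : s0.efree = true) (h1 : s1.efree = true) (h2 : s2.efree = true)
    (h3 : s3.efree = true) : (W4 s0 s1 s2 s3).efree := by
  intro f
  fin_cases f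
  · simpa [W4] using h0
  · simpa [W4] using h1
  · simpa [W4] using h2
  · simpa [W4] using h3

theorem wH0_W4 : wH0 = W4 .h .one .one .one := rfl
theorem wP_W4 : wP = W4 .pt .one .one .one := rfl
theorem wPH_W4 : wPH = W4 .pt .h .one .one := rfl
theorem wPP_W4 : wPP = W4 .pt .pt .one .one := rfl
theorem wPPH_W4 : wPPH = W4 .pt .pt .h .one := rfl
theorem wPPP_W4 : wPPP = W4 .pt .pt .pt .one := rfl
theorem wPPPH_W4 : wPPPH = W4 .pt .pt .pt .h := rfl
theorem wPPPP_W4 : wPPPP = W4 .pt .pt .pt .pt := rfl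

/-- Re-placement under (A1).2 between two e-free `W4`-words of equal degree. -/
theorem replace (D : Design) (h1 : D.A1) {s0 s1 s2 s3 t0 t1 t2 t3 : Sym}
    (hs : s0.efree = true ∧ s1.efree = true ∧ s2.efree = true ∧ s3.efree = true)
    (ht : t0.efree = true ∧ t1.efree = true ∧ t2.efree = true ∧ t3.efree = true)
    (hd : (W4 s0 s1 s2 s3).deg = (W4 t0 t1 t2 t3).deg) : D.Tz (W4 s0 s1 s2 s3) = D.Tz (W4 t0 t1 t2 t3) :=
  Tz_eq_of_A1 D h1 _ _ (W4_efree hs.1 hs.2.1 hs.2.2.1 hs.2.2.2) (W4_efree ht.1 ht.2.1 ht.2.2.1 ht.2.2.2) hd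

/-- THE TRUE-LINE TOWER (any `h`): `q_d = h^{d−1}·(d·q₁ − (d−1)·h·rank)`, `d = 2 … 8`, on the canonical placements of `SlotLatticeLaw`. -/
theorem line_tower (h : ℤ) (D : Design) (hA : D.OnAlphabet h) (hL : OnLine D) (h1 : D.A1) :
    D.Tz wP = 2 * h * D.Tz wH0 - h ^ 2 * D.rank ∧
    D.Tz wPH = 3 * h ^ 2 * D.Tz wH0 - 2 * h ^ 3 * D.rank ∧
    D.Tz wPP = 4 * h ^ 3 * D.Tz wH0 - 3 * h ^ 4 * D.rank ∧
    D.Tz wPPH = 5 * h ^ 4 * D.Tz wH0 - 4 * h ^ 5 * D.rank ∧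
    D.Tz wPPP = 6 * h ^ 5 * D.Tz wH0 - 5 * h ^ 6 * D.rank ∧
    D.Tz wPPPH = 7 * h ^ 6 * D.Tz wH0 - 6 * h ^ 7 * D.rank ∧
    D.Tz wPPPP = 8 * h ^ 7 * D.Tz wH0 - 7 * h ^ 8 * D.rank := by
  have R := line_rec h D hA hL
  have r0 := Tz_oooo D
  rw [wH0_W4, wP_W4, wPH_W4, wPP_W4, wPPH_W4, wPPP_W4, wPPPH_W4, wPPPP_W4]
  -- degree 2
  have r2 : D.Tz (W4 .pt .one .one .one) = 2 * h * D.Tz (W4 .h .one .one .one) - h ^ 2 * D.rank := by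
    rw [R, r0]
  -- degree 3
  have a3 : D.Tz (W4 .h .h .one .one) = D.Tz (W4 .pt .one .one .one) :=
    replace D h1 (by decide) (by decide) (by decide)
  have b3 : D.Tz (W4 .one .h .one .one) = D.Tz (W4 .h .one .one .one) :=
    replace D h1 (by decide) (by decide) (by decide)
  have r3 : D.Tz (W4 .pt .h .one .one) = 3 * h ^ 2 * D.Tz (W4 .h .one .one .one) - 2 * h ^ 3 * D.rank := by
    rw [R, a3, b3, r2]; ring
  -- degree 4
  have a4 : D.Tz (W4 .h .pt .one .one) = D.Tz (W4 .pt .h .one .one) :=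
    replace D h1 (by decide) (by decide) (by decide)
  have b4 : D.Tz (W4 .one .pt .one .one) = D.Tz (W4 .pt .one .one .one) :=
    replace D h1 (by decide) (by decide) (by decide)
  have r4 : D.Tz (W4 .pt .pt .one .one) = 4 * h ^ 3 * D.Tz (W4 .h .one .one .one) - 3 * h ^ 4 * D.rank := by
    rw [R, a4, b4, r3, r2]; ring
  -- degree 5
  have a5 : D.Tz (W4 .h .pt .h .one) = D.Tz (W4 .pt .pt .one .one) :=
    replace D h1 (by decide) (by decide) (by decide)
  have b5 : D.Tz (W4 .one .pt .h .one) = D.Tz (W4 .pt .h .one .one) :=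
    replace D h1 (by decide) (by decide) (by decide)
  have r5 : D.Tz (W4 .pt .pt .h .one) = 5 * h ^ 4 * D.Tz (W4 .h .one .one .one) - 4 * h ^ 5 * D.rank := by
    rw [R, a5, b5, r4, r3]; ring
  -- degree 6
  have a6 : D.Tz (W4 .h .pt .pt .one) = D.Tz (W4 .pt .pt .h .one) :=
    replace D h1 (by decide) (by decide) (by decide)
  have b6 : D.Tz (W4 .one .pt .pt .one) = D.Tz (W4 .pt .pt .one .one) :=
    replace D h1 (by decide) (by decide) (by decide)
  have r6 : D.Tz (W4 .pt .pt .pt .one) = 6 * h ^ 5 * D.Tz (W4 .h .one .one .one) - 5 * h ^ 6 * D.rank := by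
    rw [R, a6, b6, r5, r4]; ring
  -- degree 7
  have a7 : D.Tz (W4 .h .pt .pt .h) = D.Tz (W4 .pt .pt .pt .one) :=
    replace D h1 (by decide) (by decide) (by decide)
  have b7 : D.Tz (W4 .one .pt .pt .h) = D.Tz (W4 .pt .pt .h .one) :=
    replace D h1 (by decide) (by decide) (by decide)
  have r7 : D.Tz (W4 .pt .pt .pt .h) = 7 * h ^ 6 * D.Tz (W4 .h .one .one .one) - 6 * h ^ 7 * D.rank := by
    rw [R, a7, b7, r6, r5]; ring
  -- degree 8
  have a8 : D.Tz (W4 .h .pt .pt .pt) = D.Tz (W4 .pt .pt .pt .h) :=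
    replace D h1 (by decide) (by decide) (by decide)
  have b8 : D.Tz (W4 .one .pt .pt .pt) = D.Tz (W4 .pt .pt .pt .one) :=
    replace D h1 (by decide) (by decide) (by decide)
  have r8 : D.Tz (W4 .pt .pt .pt .pt) = 8 * h ^ 7 * D.Tz (W4 .h .one .one .one) - 7 * h ^ 8 * D.rank := by
    rw [R, a8, b8, r7, r6]; ring
  exact ⟨r2, r3, r4, r5, r6, r7, r8⟩

/-! ## §5 The LINE μ-law `μ ∈ 32ℤ[i]` -/

/-- At even height the LINE tower gives `q₄ ∈ 16ℤ` (vs. `8ℤ`, optimal, on the full alphabet). -/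
theorem line_q4_sixteen (h : ℤ) (hh : (2 : ℤ) ∣ h) (D : Design) (hA : D.OnAlphabet h) (hL : OnLine D) (h1 : D.A1) :
    (16 : ℤ) ∣ D.Tz wPP := by
  obtain ⟨_, _, r4, _⟩ := line_tower h D hA hL h1
  obtain ⟨k, hk⟩ := hh
  obtain ⟨m, hm⟩ := two_dvd_q1 h ⟨k, hk⟩ D hA h1
  rw [r4, hm, hk]
  exact ⟨4 * k ^ 3 * m - 3 * k ^ 4 * D.rank, by ring⟩

/-- THE μ-COUPLING at height `h` (= `ChargeLatticeLaw.mu_law`, proved there for even `h`): `Re μ ≡ Im μ ≡ 2q₄ (mod 32)`. -/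
def MuCoupling (h : ℤ) : Prop :=
  ∀ D : Design, D.OnAlphabet h → D.A1 → (32 : ℤ) ∣ 2 * D.Tz wPP - D.mu.re ∧ (32 : ℤ) ∣ 2 * D.Tz wPP - D.mu.im

/-- arithmetic: `32 ∣ 2q − Re μ`, `32 ∣ 2q − Im μ`, `16 ∣ q` ⇒ `32 ∣ Re μ, Im μ`. -/
theorem mu32_of_q4 (D : Design) (q : ℤ) (hc : (32 : ℤ) ∣ 2 * q - D.mu.re ∧ (32 : ℤ) ∣ 2 * q - D.mu.im) (hq : (16 : ℤ) ∣ q) :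
    (32 : ℤ) ∣ D.mu.re ∧ (32 : ℤ) ∣ D.mu.im := by
  obtain ⟨⟨b, hb⟩, ⟨c, hc'⟩⟩ := hc
  obtain ⟨a, ha⟩ := hq
  exact ⟨⟨a - b, by linarith⟩, ⟨a - c, by linarith⟩⟩

/-- LINE μ-LAW at even height, modulo the coupling. -/
theorem line_mu_law_even_of (h : ℤ) (hh : (2 : ℤ) ∣ h) (hμ : MuCoupling h) (D : Design) (hA : D.OnAlphabet h) (hL : OnLine D)
    (h1 : D.A1) : (32 : ℤ) ∣ D.mu.re ∧ (32 : ℤ) ∣ D.mu.im :=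
  mu32_of_q4 D _ (hμ D hA h1) (line_q4_sixteen h hh D hA hL h1)

/-- LINE μ-LAW at EVERY height, modulo the coupling at even heights (odd `h`: shift up by one). -/
theorem line_mu_law_of (hμ : ∀ h' : ℤ, (2 : ℤ) ∣ h' → MuCoupling h') (h : ℤ) (D : Design) (hA : D.OnAlphabet h) (hL : OnLine D)
    (h1 : D.A1) : (32 : ℤ) ∣ D.mu.re ∧ (32 : ℤ) ∣ D.mu.im := by
  rcases Int.even_or_odd h with ⟨k, hk⟩ | ⟨k, hk⟩
  · exact line_mu_law_even_of h ⟨k, by rw [hk]; ring⟩ (hμ h ⟨k, by rw [hk]; ring⟩) D hA hL h1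
  · have h32 := line_mu_law_even_of (h + 1) ⟨k + 1, by rw [hk]; ring⟩ (hμ (h + 1) ⟨k + 1, by rw [hk]; ring⟩) (shiftD 1 D)
      (onAlphabet_shift_up D h 1 (by norm_num) hA) (onLine_shiftD 1 D hL) (a1_shiftD 1 D h1)
    rwa [mu_shiftD] at h32

/-- The LINE CHARGE LAW as an S⁺-shaped `Prop` (proved for every `h` in `LineChargeMuLaw.lineChargeLaw_holds`). -/
def LineChargeLaw (h : ℤ) : Prop :=
  ∀ D : Design, D.OnAlphabet h → OnLine D → D.A1 → (32 : ℤ) ∣ D.mu.re ∧ (32 : ℤ) ∣ D.mu.im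

theorem lineChargeLaw_of (hμ : ∀ h' : ℤ, (2 : ℤ) ∣ h' → MuCoupling h') (h : ℤ) : LineChargeLaw h :=
  fun D hA hL h1 => line_mu_law_of hμ h D hA hL h1

/-- `32 ∣ Re μ ∧ 32 ∣ Im μ` as `32 ∣ μ` in `ℤ[i]`. -/
theorem thirtytwo_dvd_mu_of (D : Design) (h32 : (32 : ℤ) ∣ D.mu.re ∧ (32 : ℤ) ∣ D.mu.im) : (32 : GaussianInt) ∣ D.mu := by
  obtain ⟨⟨a, ha⟩, ⟨b, hb⟩⟩ := h32
  refine ⟨⟨a, b⟩, ?_⟩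
  rw [Zsqrtd.ext_iff]; constructor <;> simp [ha, hb]

/-- Helper: `μ ∈ 32ℤ[i]`, `μ ≠ 0` ⇒ `|μ|² ≥ 1024`. -/
theorem normSq_ge_of_thirtytwo_dvd (D : Design) (h32 : (32 : ℤ) ∣ D.mu.re ∧ (32 : ℤ) ∣ D.mu.im) (hμ : D.mu ≠ 0) :
    1024 ≤ D.mu.re ^ 2 + D.mu.im ^ 2 := by
  obtain ⟨⟨a, ha⟩, ⟨b, hb⟩⟩ := h32
  have hab : 1 ≤ a ^ 2 + b ^ 2 := by
    by_contra hneg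
    have ha2 : a ^ 2 = 0 := by nlinarith [sq_nonneg a, sq_nonneg b]
    have hb2 : b ^ 2 = 0 := by nlinarith [sq_nonneg a, sq_nonneg b]
    have ha0 : a = 0 := (pow_eq_zero_iff two_ne_zero).mp ha2
    have hb0 : b = 0 := (pow_eq_zero_iff two_ne_zero).mp hb2
    apply hμ
    rw [Zsqrtd.ext_iff]; refine ⟨?_, ?_⟩ <;> simp [ha, hb, ha0, hb0]
  rw [ha, hb]; nlinarith [hab]

/-- Helper: `μ ∈ 32ℤ[i]` ⇒ `|μ|² ≠ 512`. -/
theorem normSq_ne_512_of_thirtytwo_dvd (D : Design) (h32 : (32 : ℤ) ∣ D.mu.re ∧ (32 : ℤ) ∣ D.mu.im) :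
    D.mu.re ^ 2 + D.mu.im ^ 2 ≠ 512 := by
  obtain ⟨⟨a, ha⟩, ⟨b, hb⟩⟩ := h32
  rw [ha, hb]
  intro h512
  have : 2 * (a ^ 2 + b ^ 2) = 1 := by nlinarith [h512]
  omega

/-! ## §7 THE ONE-SLOT LAW: `|μ| < 32` needs an odd-odd letter in EVERY factor

The μ-half of the LINE law is a special case of a PARITY law.  Call a letter ODD-ODD when `x ≡ y ≡ 1 (mod 2)` (equivalently
`v_{1+i}(β) = 1`; axis letters never are).  At even height every letter that is NOT odd-odd has `4 ∣ n = a² − |β|²` (odd-odd ones have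
`n ≡ 2 (mod 4)`).  ONE-SLOT LAW: if ONE factor `f` of the support carries no odd-odd letter then `μ ∈ 32ℤ[i]`.  Proof (factor `f = 2`,
even `h`): `ChargeLatticeLaw.Φ2_po` is the identity `Σ_c m(c)·2(a₀+x₀+y₀)·2(a₁+x₁+y₁)·n₂ = 4·T(h h p 1) = 4·q₄` ((A1).1 kills the eight
e-mixed words of the expansion); cell-wise `4 ∣ 2(a+x+y)` (letter parity) twice and `4 ∣ n₂` (no odd-odd letter in factor 2) give `64 ∣ 4q₄`,
`16 ∣ q₄`, and `ChargeLatticeLaw.mu_law` (`Re μ ≡ Im μ ≡ 2q₄ (mod 32)`) gives `32 ∣ Re μ, Im μ`.  Other factors: permute the factors of every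
cell (`permD`: (A1), the alphabet and μ are invariant); odd heights: shift up by one (`HeightTower.shiftD`).  Hence (FOUR-FACTOR THEOREM,
`oddOdd_every_factor_of_small_mu`) a design with `0 < |μ|² < 1024` — i.e. `μ = ±16 ± 16i` — has an odd-odd letter in EACH of the four factors
of its support.  EXACT companion (engine `memo-21/eng/perslot.py`, per-factor alphabets at `h = 16`): with the odd-odd letters removed from ONE
factor the charge lattice has `q₄ ∈ 16ℤ`, `μ ∈ 32ℤ ⊕ 32ℤ·i` (index `2⁴⁰`); with all four factors full, `q₄ ∈ 8ℤ` and `μ = 16+16i` occurs — so the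
law is sharp.  By classes of `β mod 2` (AX axis ∕ EE ∕ EO ∕ OO, engine `scan3.py`, `h = 12, 14, 15, 16`): μ-lattice `32ℤ[i]` for every alphabet
without OO letters, `256(1+i)ℤ[i]` for EE alone, `64(1+i)ℤ[i]` for OO alone, for EE+OO and for the DIAGONAL `|x| = |y|`; the full `16`-lattice
`{Re ≡ Im (32)} ∩ 16ℤ[i]` appears exactly when an OO class meets AX or EO. -/

/-- An ODD-ODD letter: `x ≡ y ≡ 1 (mod 2)`. -/
def oddOdd (ℓ : Letter) : Prop := Odd ℓ.x ∧ Odd ℓ.y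

theorem not_oddOdd_of_isAxis (ℓ : Letter) (hx : ℓ.isAxis) : ¬ oddOdd ℓ := by
  unfold Letter.isAxis at hx
  rintro ⟨⟨s, hs⟩, ⟨t, ht⟩⟩
  rcases mul_eq_zero.mp hx with h0 | h0 <;> omega

/-- At even height a letter that is not odd-odd has `4 ∣ n`. -/
theorem four_dvd_selfInt (h : ℤ) (hh : (2 : ℤ) ∣ h) (ℓ : Letter) (hℓ : ℓ.OnAlphabet h) (hno : ¬ oddOdd ℓ) :
    (4 : ℤ) ∣ ℓ.selfInt := by
  obtain ⟨p, hp⟩ := letter_parity h ℓ hℓ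
  obtain ⟨k, hk⟩ := hh
  have ha : ℓ.a = 2 * p - ℓ.x - ℓ.y + 2 * k := by linarith
  unfold Letter.selfInt Letter.bnorm
  rw [ha]
  rcases Int.even_or_odd ℓ.x with ⟨s, hs⟩ | ⟨s, hs⟩ <;> rcases Int.even_or_odd ℓ.y with ⟨t, ht⟩ | ⟨t, ht⟩
  · rw [hs, ht]; exact ⟨(p - s - t + k) ^ 2 - s ^ 2 - t ^ 2, by ring⟩
  · rw [hs, ht]; exact ⟨(p - s - t + k) ^ 2 - (p - s - t + k) - s ^ 2 - t ^ 2 - t, by ring⟩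
  · rw [hs, ht]; exact ⟨(p - s - t + k) ^ 2 - (p - s - t + k) - s ^ 2 - s - t ^ 2, by ring⟩
  · exact absurd ⟨⟨s, hs⟩, ⟨t, ht⟩⟩ hno

/-- An odd-odd letter at even height has `n ≡ 2 (mod 4)` (so the hypothesis of `four_dvd_selfInt` is sharp). -/
theorem selfInt_oddOdd (h : ℤ) (hh : (2 : ℤ) ∣ h) (ℓ : Letter) (hℓ : ℓ.OnAlphabet h) (ho : oddOdd ℓ) :
    (4 : ℤ) ∣ ℓ.selfInt - 2 := by
  obtain ⟨p, hp⟩ := letter_parity h ℓ hℓ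
  obtain ⟨k, hk⟩ := hh
  obtain ⟨⟨s, hs⟩, ⟨t, ht⟩⟩ := ho
  have ha : ℓ.a = 2 * p - ℓ.x - ℓ.y + 2 * k := by linarith
  unfold Letter.selfInt Letter.bnorm
  rw [ha, hs, ht]
  exact ⟨(p - s - t + k - 1) ^ 2 - s ^ 2 - s - t ^ 2 - t - 1, by ring⟩

/-- No support cell carries an odd-odd letter in factor `f`. -/
def NoOddOddSlot (D : Design) (f : Fin 4) : Prop := ∀ c ∈ D.suppN ++ D.suppP, ¬ oddOdd (c f)

/-- No odd-odd letter anywhere in the support (LINE designs; the alphabets AX, EE, EO and their unions). -/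
def NoOddOdd (D : Design) : Prop := ∀ c ∈ D.suppN ++ D.suppP, ∀ f : Fin 4, ¬ oddOdd (c f)

theorem noOddOddSlot_of_noOddOdd (D : Design) (hO : NoOddOdd D) (f : Fin 4) : NoOddOddSlot D f :=
  fun c hc => hO c hc f

theorem noOddOdd_of_onLine (D : Design) (hL : OnLine D) : NoOddOdd D :=
  fun c hc f => not_oddOdd_of_isAxis _ (hL c hc f)

theorem mem_supp_of_N (D : Design) (cm : Cell × ℕ) (hcm : cm ∈ D.N) (hpos : 0 < cm.2) : cm.1 ∈ D.suppN ++ D.suppP :=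
  List.mem_append.mpr (Or.inl ((mem_suppN_iff D cm.1).mpr ⟨cm.2, hcm, hpos⟩))

theorem mem_supp_of_P (D : Design) (cm : Cell × ℕ) (hcm : cm ∈ D.P) (hpos : 0 < cm.2) : cm.1 ∈ D.suppN ++ D.suppP :=
  List.mem_append.mpr (Or.inr ((mem_suppP_iff D cm.1).mpr ⟨cm.2, hcm, hpos⟩))

/-! ### §7.2 Factor permutations (the other three factors) -/

/-- permute the factors of a cell: `(permCell σ c) i = c (σ i)`. -/
def permCell (σ : Equiv.Perm (Fin 4)) (c : Cell) : Cell := fun i => c (σ i)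

/-- permute the factors of every cell of a design (multiplicities unchanged). -/
def permD (σ : Equiv.Perm (Fin 4)) (D : Design) : Design := mapD (permCell σ) D

theorem cellCoef_permCell (σ : Equiv.Perm (Fin 4)) (c : Cell) (w : Word) :
    cellCoef (permCell σ c) w = cellCoef c (fun j => w (σ.symm j)) := by
  have key := Equiv.prod_comp σ (fun j => (w (σ.symm j)).coef (c j))
  simp only [Equiv.symm_apply_apply] at key
  simpa [cellCoef, permCell] using key

theorem T_permD (σ : Equiv.Perm (Fin 4)) (D : Design) (w : Word) :
    (permD σ D).T w = D.T (fun j => w (σ.symm j)) := by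
  unfold permD; rw [T_mapD, T_eq_Tf]; exact Tf_congr D (fun c => cellCoef_permCell σ c w)

/-- μ is invariant under factor permutations. -/
theorem mu_permD (σ : Equiv.Perm (Fin 4)) (D : Design) : (permD σ D).mu = D.mu := by
  have e : (fun j => Word.eeee (σ.symm j)) = Word.eeee := rfl
  unfold Design.mu; rw [T_permD, e]

theorem efree_perm (τ : Equiv.Perm (Fin 4)) (w : Word) : (Word.efree fun j => w (τ j)) ↔ w.efree := by
  unfold Word.efree
  constructor
  · intro hw f; simpa using hw (τ.symm f)
  · intro hw f; exact hw (τ f)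

theorem deg_perm (τ : Equiv.Perm (Fin 4)) (w : Word) : (Word.deg fun j => w (τ j)) = w.deg := by
  unfold Word.deg; exact Equiv.sum_comp τ (fun j => (w j).deg)

theorem eq_eeee_of_perm (τ : Equiv.Perm (Fin 4)) (w : Word) (hw : (fun j => w (τ j)) = Word.eeee) : w = Word.eeee := by
  funext f; simpa [Word.eeee] using congrFun hw (τ.symm f)

theorem eq_EEEE_of_perm (τ : Equiv.Perm (Fin 4)) (w : Word) (hw : (fun j => w (τ j)) = Word.EEEE) : w = Word.EEEE := by
  funext f; simpa [Word.EEEE] using congrFun hw (τ.symm f)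

/-- (A1) is invariant under factor permutations. -/
theorem a1_permD (σ : Equiv.Perm (Fin 4)) (D : Design) (h1 : D.A1) : (permD σ D).A1 := by
  refine ⟨?_, ?_⟩
  · intro w hw he hE
    rw [T_permD]
    refine h1.1 _ ?_ ?_ ?_
    · exact fun hf => hw ((efree_perm σ.symm w).mp hf)
    · exact fun hf => he (eq_eeee_of_perm σ.symm w hf)
    · exact fun hf => hE (eq_EEEE_of_perm σ.symm w hf)
  · intro w w' hw hw' hd
    rw [T_permD, T_permD]
    exact h1.2 _ _ ((efree_perm σ.symm w).mpr hw) ((efree_perm σ.symm w').mpr hw') (by rw [deg_perm, deg_perm]; exact hd)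

theorem supp_permD (σ : Equiv.Perm (Fin 4)) (D : Design) :
    (permD σ D).suppN ++ (permD σ D).suppP = (D.suppN ++ D.suppP).map (permCell σ) := by
  unfold permD; rw [List.map_append, suppN_mapD, suppP_mapD]

/-- the alphabet is invariant under factor permutations. -/
theorem onAlphabet_permD (σ : Equiv.Perm (Fin 4)) (D : Design) (h : ℤ) (hA : D.OnAlphabet h) : (permD σ D).OnAlphabet h := by
  intro c hc f
  rw [supp_permD] at hc
  obtain ⟨c₀, hc₀, rfl⟩ := List.mem_map.mp hc
  simpa [permCell] using hA c₀ hc₀ (σ f)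

theorem noOddOddSlot_permD (σ : Equiv.Perm (Fin 4)) (D : Design) (f : Fin 4) (hO : NoOddOddSlot D (σ f)) :
    NoOddOddSlot (permD σ D) f := by
  intro c hc
  rw [supp_permD] at hc
  obtain ⟨c₀, hc₀, rfl⟩ := List.mem_map.mp hc
  simpa [permCell] using hO c₀ hc₀

theorem noOddOddSlot_shiftD (t : ℤ) (D : Design) (f : Fin 4) (hO : NoOddOddSlot D f) : NoOddOddSlot (shiftD t D) f := by
  intro c hc
  have hc' : c ∈ (D.suppN ++ D.suppP).map (shiftCell t) := by
    rw [List.map_append, ← suppN_shift, ← suppP_shift]; exact hc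
  obtain ⟨c₀, hc₀, rfl⟩ := List.mem_map.mp hc'
  simpa [shiftCell, shiftL, oddOdd] using hO c₀ hc₀

/-! ### §7.3 The ONE-SLOT LAW modulo the two charge-lattice inputs -/

/-- THE SLOT-2 INPUT at height `h` (proved for even `h` in `LineChargeMuLaw.slot2Q4Law_holds` from `ChargeLatticeLaw.Φ2_po`):
no odd-odd letter in factor 2 ⇒ `16 ∣ q₄`. -/
def Slot2Q4Law (h : ℤ) : Prop :=
  ∀ D : Design, D.OnAlphabet h → D.A1 → NoOddOddSlot D 2 → (16 : ℤ) ∣ D.Tz wPP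

/-- ONE-SLOT LAW at even height, modulo the inputs: move factor `f` to factor 2 by `Equiv.swap 2 f`. -/
theorem slot_mu_law_even_of (h : ℤ) (hq : Slot2Q4Law h) (hμ : MuCoupling h) (D : Design) (hA : D.OnAlphabet h) (h1 : D.A1)
    (f : Fin 4) (hO : NoOddOddSlot D f) : (32 : ℤ) ∣ D.mu.re ∧ (32 : ℤ) ∣ D.mu.im := by
  have hO' : NoOddOddSlot (permD (Equiv.swap 2 f) D) 2 :=
    noOddOddSlot_permD (Equiv.swap 2 f) D 2 (by rwa [Equiv.swap_apply_left])
  have hA' := onAlphabet_permD (Equiv.swap 2 f) D h hA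
  have h1' := a1_permD (Equiv.swap 2 f) D h1
  have key := mu32_of_q4 _ _ (hμ _ hA' h1') (hq _ hA' h1' hO')
  rwa [mu_permD] at key

/-- ONE-SLOT LAW at EVERY height, modulo the inputs at even heights. -/
theorem slot_mu_law_of (hq : ∀ h' : ℤ, (2 : ℤ) ∣ h' → Slot2Q4Law h') (hμ : ∀ h' : ℤ, (2 : ℤ) ∣ h' → MuCoupling h') (h : ℤ)
    (D : Design) (hA : D.OnAlphabet h) (h1 : D.A1) (f : Fin 4) (hO : NoOddOddSlot D f) :
    (32 : ℤ) ∣ D.mu.re ∧ (32 : ℤ) ∣ D.mu.im := by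
  rcases Int.even_or_odd h with ⟨k, hk⟩ | ⟨k, hk⟩
  · have hh : (2 : ℤ) ∣ h := ⟨k, by rw [hk]; ring⟩
    exact slot_mu_law_even_of h (hq h hh) (hμ h hh) D hA h1 f hO
  · have hh : (2 : ℤ) ∣ h + 1 := ⟨k + 1, by rw [hk]; ring⟩
    have h32 := slot_mu_law_even_of (h + 1) (hq _ hh) (hμ _ hh) (shiftD 1 D)
      (onAlphabet_shift_up D h 1 (by norm_num) hA) (a1_shiftD 1 D h1) f (noOddOddSlot_shiftD 1 D f hO)
    rwa [mu_shiftD] at h32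

/-- The ONE-SLOT LAW as an S⁺-shaped `Prop` (proved for every `h` in `LineChargeMuLaw.oneSlotLaw_holds`). -/
def OneSlotLaw (h : ℤ) : Prop :=
  ∀ D : Design, D.OnAlphabet h → D.A1 → ∀ f : Fin 4, NoOddOddSlot D f → (32 : ℤ) ∣ D.mu.re ∧ (32 : ℤ) ∣ D.mu.im

theorem oneSlotLaw_of (hq : ∀ h' : ℤ, (2 : ℤ) ∣ h' → Slot2Q4Law h') (hμ : ∀ h' : ℤ, (2 : ℤ) ∣ h' → MuCoupling h') (h : ℤ) :
    OneSlotLaw h := fun D hA h1 f hO => slot_mu_law_of hq hμ h D hA h1 f hO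

/-- The one-slot law contains the LINE law (axis letters are never odd-odd). -/
theorem lineChargeLaw_of_oneSlotLaw (h : ℤ) (H : OneSlotLaw h) : LineChargeLaw h :=
  fun D hA hL h1 => H D hA h1 0 (noOddOddSlot_of_noOddOdd D (noOddOdd_of_onLine D hL) 0)

/-- FOUR-FACTOR THEOREM modulo the law: `0 < |μ|² < 1024` ⇒ an odd-odd letter in EVERY factor of the support. -/
theorem oddOdd_every_factor_of_small_mu_of (h : ℤ) (H : OneSlotLaw h) (D : Design) (hA : D.OnAlphabet h) (h1 : D.A1)
    (hμ : D.mu ≠ 0) (hlt : D.mu.re ^ 2 + D.mu.im ^ 2 < 1024) (f : Fin 4) : ∃ c ∈ D.suppN ++ D.suppP, oddOdd (c f) := by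
  by_contra hno
  push Not at hno
  exact absurd (normSq_ge_of_thirtytwo_dvd D (H D hA h1 f hno) hμ) (not_le.mpr hlt)

end Summit.HodgeConjecture.HodgeConjecture.Cruxes.BlochSeedDiscOne.LineChargeLaw
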